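import Literature.NumberTheory.DiophantineGeometry.GenEllConjugateCompactness
import HarnessLib

/-!
# [GenEll] Thm. 2.1 (ii) ⇒ (i) for `ℙ¹`: the spine PER `ε` — Vojta in degree `≤ d` for ONE `ε`
# from an `ε`-dependent menu of mechanisms with exact avoidance

S. Mochizuki, *Arithmetic elliptic curves in general position*, Math. J. Okayama Univ. 52 (2010)
[cite: MochizukiGenEll2010, Thm 2.1 p.12], proof of Thm. 2.1, p. 12: "for `e ≫ 0` … it suffices to
verify the inequality … for arbitrary `ε′`" — the auxiliary cover `Y → X` (the degree `e` of the curve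
`D_e` in the number-field route, cell abc-iut GENELLTWO-P1ROUTE §3) is chosen AFTER `ε`, because the
mechanism on a FIXED `D_e` delivers Vojta's inequality only with the constant
`e(1+ε′)/(e−3−δ₂) ≥ e/(e−3)` (the Riemann–Hurwitz loss of the degree-`e` cover, §3 (★)). Hence the
spine must be consumed one `ε` at a time, with the menu `M = M(ε)`.

Proof-only companion of `GenEllMenuSpine` (abc-iut-S6, `vojtaP1Deg_of_menu`, whose hypothesis
`hmech` asks every mechanism for EVERY `ε > 0` with the menu fixed first — true as an implication but
not instantiable by a fixed-`e` mechanism; referee note F-SPINE of abc-iut-w5-d075, 2026-08-26):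

* `vojtaIneq_univ_of_menu` — the SAME spine with `ε` pulled out: for ONE `ε > 0`, a menu `M` whose
  mechanisms deliver `VojtaIneq … d ε` on their good sets (at every radius) and which exactly avoids
  every configuration of `≤ d + d` conjugate slots gives `VojtaIneq Set.univ d ε`. The closing theorem
  then reads `fun ε hε => vojtaIneq_univ_of_menu d hε (menu built on D_{e(ε)}) …`.

The proof is abc-iut-S6's, verbatim after its first `intro`. Theorems only; no definitions, no named
facts; classical; nothing here bears on [IUTchIII] Cor. 3.12.
-/

noncomputable section

open NumberField

namespace Literature.NumberTheory.DiophantineGeometry.GenEll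

/-- A finite family of positive reals indexed by `Fin d` has a positive lower bound.
[cite: MochizukiGenEll2010, Thm 2.1 p.12] -/
theorem exists_pos_le_forall_fin {d : ℕ} (ρ : Fin d → ℝ) (hρ : ∀ j, 0 < ρ j) :
    ∃ r : ℝ, 0 < r ∧ ∀ j, r ≤ ρ j := by
  classical
  by_cases hd : d = 0
  · subst hd; exact ⟨1, one_pos, fun j => Fin.elim0 j⟩
  · haveI : Nonempty (Fin d) := ⟨⟨0, Nat.pos_of_ne_zero hd⟩⟩
    obtain ⟨j₀, -, hj₀⟩ := Finset.exists_min_image Finset.univ ρ Finset.univ_nonempty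
    exact ⟨ρ j₀, hρ j₀, fun j => hj₀ j (Finset.mem_univ j)⟩

/-- **The spine, per `ε`: [GenEll] Thm. 2.1 (i) for `ℙ¹` in degree `≤ d` at ONE `ε > 0` from a menu
of mechanisms with exact avoidance** (prime `2`, the support `Σ = {2}` of `GenEllTwo`). Data:
mechanisms `m : M` (the menu may depend on `ε`); for each `m` and radius `r`, condition sets
`U m r ⊆ ℂ` and `V m r ⊆ Q̄_2`, open, antitone in `r`, each containing a neighbourhood of `∞`;
pointwise avoidance predicates `A m : ℂ → Prop`, `B m : Q̄_2 → Prop` with `A m z → ∃ r > 0, z ∈ U m r`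
(and the same for `B`, `V`). Hypotheses: (mechanisms, AT THIS `ε`) for every `m` and `r > 0`, Vojta's
inequality with `1 + ε` holds in degree `≤ d` on the points all of whose conjugates lie in `U m r`
(at `∞`) and in `V m r` (at `2`); (exact cover) every configuration of `d` points of `ℂ ∪ {∞}` and `d`
points of `Q̄_2 ∪ {∞}` is avoided, entry by entry (`∞` always admissible), by some mechanism.
Conclusion: `VojtaIneq Set.univ d ε`. (abc-iut-S6's `vojtaP1Deg_of_menu` with `ε` moved outside the
menu; radii chosen after the mechanism, finiteness of the subcover = `GenEllConjugateCompactness`.)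
[cite: MochizukiGenEll2010, Thm 2.1 p.12] -/
theorem vojtaIneq_univ_of_menu (d : ℕ) {ε : ℝ} {M : Type*}
    (U : M → ℝ → Set ℂ) (V : M → ℝ → Set (PadicAlgCl 2))
    (hUopen : ∀ m r, IsOpen (U m r)) (hVopen : ∀ m r, IsOpen (V m r))
    (hUinf : ∀ m r, 0 < r → ∃ R : ℝ, ∀ z : ℂ, R < ‖z‖ → z ∈ U m r)
    (hVinf : ∀ m r, 0 < r → ∃ R : ℝ, ∀ z : PadicAlgCl 2, R < ‖z‖ → z ∈ V m r)
    (hUmono : ∀ m {r r' : ℝ}, r ≤ r' → U m r' ⊆ U m r)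
    (hVmono : ∀ m {r r' : ℝ}, r ≤ r' → V m r' ⊆ V m r)
    (A : M → ℂ → Prop) (B : M → PadicAlgCl 2 → Prop)
    (hA : ∀ m z, A m z → ∃ r : ℝ, 0 < r ∧ z ∈ U m r)
    (hB : ∀ m y, B m y → ∃ r : ℝ, 0 < r ∧ y ∈ V m r)
    (hmech : ∀ m (r : ℝ), 0 < r →
      VojtaIneq {P : NFPoint | (∀ σ : P.F →+* ℂ, σ P.x ∈ U m r) ∧
        (∀ σ : P.F →+* PadicAlgCl 2, σ P.x ∈ V m r)} d ε)
    (hcover : ∀ (a : Fin d → OnePoint ℂ) (b : Fin d → OnePoint (PadicAlgCl 2)), ∃ m : M,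
      (∀ j, a j = OnePoint.infty ∨ ∃ z : ℂ, a j = ↑z ∧ A m z) ∧
        (∀ j, b j = OnePoint.infty ∨ ∃ y : PadicAlgCl 2, b j = ↑y ∧ B m y)) :
    VojtaIneq Set.univ d ε := by
  classical
  haveI : Fact (Nat.Prime 2) := ⟨Nat.prime_two⟩
  -- mechanisms indexed by (m, r) with r > 0, all open at ∞
  let ι := M × {r : ℝ // 0 < r}
  refine vojtaIneq_univ_of_cover 2 d (ι := ι) (fun i => U i.1 i.2.1) (fun i => hUopen i.1 i.2.1)
    (fun i => V i.1 i.2.1) (fun i => hVopen i.1 i.2.1) Set.univ Set.univ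
    (fun i _ => hUinf i.1 i.2.1 i.2.2) (fun i _ => hVinf i.1 i.2.1 i.2.2) ?_
    (fun i => hmech i.1 i.2.1 i.2.2)
  intro a b
  obtain ⟨m, ha, hb⟩ := hcover a b
  -- a positive radius for each entry (1 for the entries `∞`)
  have hra : ∀ j, ∃ ρ : ℝ, 0 < ρ ∧ ∀ z : ℂ, a j = ↑z → z ∈ U m ρ := by
    intro j
    rcases ha j with h | ⟨z, hz, hAz⟩
    · exact ⟨1, one_pos, fun z hz => by rw [h] at hz; exact absurd hz (OnePoint.infty_ne_coe z)⟩
    · obtain ⟨ρ, hρ, hzU⟩ := hA m z hAz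
      refine ⟨ρ, hρ, fun z' hz' => ?_⟩
      rw [hz] at hz'
      rw [← OnePoint.coe_injective hz']
      exact hzU
  have hrb : ∀ j, ∃ ρ : ℝ, 0 < ρ ∧ ∀ y : PadicAlgCl 2, b j = ↑y → y ∈ V m ρ := by
    intro j
    rcases hb j with h | ⟨y, hy, hBy⟩
    · exact ⟨1, one_pos, fun y hy => by rw [h] at hy; exact absurd hy (OnePoint.infty_ne_coe y)⟩
    · obtain ⟨ρ, hρ, hyV⟩ := hB m y hBy
      refine ⟨ρ, hρ, fun y' hy' => ?_⟩
      rw [hy] at hy'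
      rw [← OnePoint.coe_injective hy']
      exact hyV
  choose ρa hρa hUa using hra
  choose ρb hρb hVb using hrb
  obtain ⟨r₁, hr₁, hr₁le⟩ := exists_pos_le_forall_fin ρa hρa
  obtain ⟨r₂, hr₂, hr₂le⟩ := exists_pos_le_forall_fin ρb hρb
  refine ⟨⟨m, ⟨min r₁ r₂, lt_min hr₁ hr₂⟩⟩, fun j => ?_, fun j => ?_⟩
  · rcases ha j with h | ⟨z, hz, -⟩
    · exact Or.inr ⟨h, Set.mem_univ _⟩
    · refine Or.inl ⟨z, ?_, hz⟩
      exact hUmono m ((min_le_left _ _).trans (hr₁le j)) (hUa j z hz)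
  · rcases hb j with h | ⟨y, hy, -⟩
    · exact Or.inr ⟨h, Set.mem_univ _⟩
    · refine Or.inl ⟨y, ?_, hy⟩
      exact hVmono m ((min_le_right _ _).trans (hr₂le j)) (hVb j y hy)

/-- **Assembly shape for `VojtaP1Deg d`** from `ε`-DEPENDENT menus: if for every `ε > 0` some menu
(of any index type in a fixed universe, e.g. the menu on `D_{e(ε)}`) satisfies the hypotheses of
`vojtaIneq_univ_of_menu` at that `ε`, then Vojta's inequality holds in degree `≤ d` for every `ε`,
i.e. `VojtaP1Deg d`. (The `∀ ε ∃ menu` order is [GenEll] p. 12's "for `e ≫ 0`".)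
[cite: MochizukiGenEll2010, Thm 2.1 p.12] -/
theorem vojtaP1Deg_of_menu_family (d : ℕ)
    (h : ∀ ε : ℝ, 0 < ε → ∃ (M : Type) (U : M → ℝ → Set ℂ) (V : M → ℝ → Set (PadicAlgCl 2))
      (A : M → ℂ → Prop) (B : M → PadicAlgCl 2 → Prop),
      (∀ m r, IsOpen (U m r)) ∧ (∀ m r, IsOpen (V m r)) ∧
      (∀ m r, 0 < r → ∃ R : ℝ, ∀ z : ℂ, R < ‖z‖ → z ∈ U m r) ∧
      (∀ m r, 0 < r → ∃ R : ℝ, ∀ z : PadicAlgCl 2, R < ‖z‖ → z ∈ V m r) ∧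
      (∀ m (r r' : ℝ), r ≤ r' → U m r' ⊆ U m r) ∧
      (∀ m (r r' : ℝ), r ≤ r' → V m r' ⊆ V m r) ∧
      (∀ m z, A m z → ∃ r : ℝ, 0 < r ∧ z ∈ U m r) ∧
      (∀ m y, B m y → ∃ r : ℝ, 0 < r ∧ y ∈ V m r) ∧
      (∀ m (r : ℝ), 0 < r →
        VojtaIneq {P : NFPoint | (∀ σ : P.F →+* ℂ, σ P.x ∈ U m r) ∧
          (∀ σ : P.F →+* PadicAlgCl 2, σ P.x ∈ V m r)} d ε) ∧
      (∀ (a : Fin d → OnePoint ℂ) (b : Fin d → OnePoint (PadicAlgCl 2)), ∃ m : M,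
        (∀ j, a j = OnePoint.infty ∨ ∃ z : ℂ, a j = ↑z ∧ A m z) ∧
          (∀ j, b j = OnePoint.infty ∨ ∃ y : PadicAlgCl 2, b j = ↑y ∧ B m y))) :
    VojtaP1Deg d := by
  intro ε hε
  obtain ⟨M, U, V, A, B, hUo, hVo, hUi, hVi, hUm, hVm, hA, hB, hmech, hcover⟩ := h ε hε
  exact vojtaIneq_univ_of_menu d U V hUo hVo hUi hVi (fun m _ _ hrr' => hUm m _ _ hrr')
    (fun m _ _ hrr' => hVm m _ _ hrr') A B hA hB hmech hcover

end Literature.NumberTheory.DiophantineGeometry.GenEll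

end
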